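import Literature.Probability.RandomPlanarGeometry.HexParafermionProofs
import Mathlib.Data.List.TakeWhile
import HarnessLib

/-!
# Surgery of vertex lists: consecutive pairs of concatenations, splicing, first/last visits

Topic `Literature/Probability/RandomPlanarGeometry` (next to `HexParafermionProofs.lean`, whose
`edges_cons_cons`, `forall_mem_of_mem_edges`, `edges_nodup` describe the list
`zipWith s(·,·) l l.tail` of consecutive unordered pairs of a vertex list, and `SAWLists.lean`,
the splice lemma for self-avoiding vertex lists). Elementary bookkeeping for cutting a
self-avoiding walk, recorded as its vertex list, at its first and last visits to a vertex set and
gluing it back (the "first entrance / last exit decomposition" of walk surgery, e.g. N. Madras,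
G. Slade, *The Self-Avoiding Walk* (1993), §3–§4; H. Duminil-Copin, S. Smirnov, Ann. of Math. 175
(2012), §1–§2 for walks between mid-edges as vertex lists):

* consecutive pairs of concatenations: `edges_append_cons` (split at a junction entry),
  `edges_splice` (three blocks around an inner segment), `edges_concat`, `edges_cons_concat`
  (a list extended by one entry at each end), `exists_mem_of_mem_edges_cons_concat`;
* splicing the middle block of a three-block concatenation: `nodup_splice`, `isChain_splice`,
  `head?_splice_mid`, `getLast?_splice_mid`;
* the FIRST/LAST-VISIT DECOMPOSITION `L = β ++ α ++ β'` of a list at its first and last entries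
  failing a Boolean predicate `p` (`β`, `β'` satisfy `p` throughout, `α` starts and ends outside
  `p`): existence `exists_split_first_last`, uniqueness through the `takeWhile`/`dropWhile` data
  from both ends `split_first_last_eq`, and the combined characterisation `split_first_last_iff`.

Everything is [folklore]; nothing specific to a lattice is used or stated here (the mid-edge walk
applications are in `HexMidEdgeSAWDoors.lean`).
-/

namespace Literature.Probability.RandomPlanarGeometry.SAW

section EdgeLists

variable {V : Type*}

/-- The consecutive pairs of a concatenation `A ++ b :: B`, split at the junction entry `b`.
[folklore] -/
theorem edges_append_cons : ∀ (A : List V) (b : V) (B : List V),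
    List.zipWith (fun u w => s(u, w)) (A ++ b :: B) (A ++ b :: B).tail =
      List.zipWith (fun u w => s(u, w)) (A ++ [b]) (A ++ [b]).tail ++
        List.zipWith (fun u w => s(u, w)) (b :: B) (b :: B).tail
  | [], _, _ => rfl
  | [_], _, _ => rfl
  | a :: a' :: A, b, B => by
    have ih := edges_append_cons (a' :: A) b B
    simp only [List.cons_append] at ih ⊢
    rw [edges_cons_cons, edges_cons_cons, ih]
    rfl

/-- The consecutive pairs of `I ++ [p] ++ α ++ p' :: T`: the pairs of `I ++ [p]`, of the inner
segment `p :: α ++ [p']`, and of `p' :: T`. [folklore] -/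
theorem edges_splice (I : List V) (p : V) (α : List V) (p' : V) (T : List V) :
    List.zipWith (fun u w => s(u, w)) (I ++ [p] ++ α ++ p' :: T) (I ++ [p] ++ α ++ p' :: T).tail =
      List.zipWith (fun u w => s(u, w)) (I ++ [p]) (I ++ [p]).tail ++
        List.zipWith (fun u w => s(u, w)) (p :: α ++ [p']) (p :: α ++ [p']).tail ++
        List.zipWith (fun u w => s(u, w)) (p' :: T) (p' :: T).tail := by
  rw [edges_append_cons (I ++ [p] ++ α) p' T]
  have h : I ++ [p] ++ α ++ [p'] = I ++ p :: (α ++ [p']) := by simp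
  rw [h, edges_append_cons I p (α ++ [p'])]
  rfl

/-- The consecutive pairs of `L ++ [y]` for `L` with last entry `t`. [folklore] -/
theorem edges_concat {L : List V} {t : V} (ht : L.getLast? = some t) (y : V) :
    List.zipWith (fun u w => s(u, w)) (L ++ [y]) (L ++ [y]).tail =
      List.zipWith (fun u w => s(u, w)) L L.tail ++ [s(t, y)] := by
  have hne : L ≠ [] := by rintro rfl; simp at ht
  have hL : L.dropLast ++ [t] = L := by
    rw [List.getLast?_eq_some_getLast hne, Option.some.injEq] at ht
    rw [← ht, List.dropLast_concat_getLast hne]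
  conv_lhs => rw [← hL]
  rw [List.append_assoc, List.singleton_append, edges_append_cons, hL]
  rfl

/-- The consecutive pairs of `x :: L ++ [y]` for `L` with first entry `h` and last entry `t`:
`{x, h}`, the pairs of `L`, `{t, y}`. [folklore] -/
theorem edges_cons_concat {L : List V} {h t : V} (hh : L.head? = some h)
    (ht : L.getLast? = some t) (x y : V) :
    List.zipWith (fun u w => s(u, w)) (x :: L ++ [y]) (x :: L ++ [y]).tail =
      s(x, h) :: List.zipWith (fun u w => s(u, w)) L L.tail ++ [s(t, y)] := by
  obtain ⟨L', rfl⟩ : ∃ L', L = h :: L' := by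
    cases L with
    | nil => simp at hh
    | cons a L' => exact ⟨L', by simp only [List.head?_cons, Option.some.injEq] at hh; rw [hh]⟩
  have ht' : (x :: h :: L').getLast? = some t := by rw [List.getLast?_cons_cons]; exact ht
  rw [edges_concat ht' y, edges_cons_cons]

/-- Each consecutive pair of `p :: α ++ [p']` (`α` nonempty) contains an entry of `α`. [folklore] -/
theorem exists_mem_of_mem_edges_cons_concat {α : List V} {c₁ c₂ : V} (hh : α.head? = some c₁)
    (hl : α.getLast? = some c₂) (p p' : V) {e : Sym2 V}
    (he : e ∈ List.zipWith (fun u w => s(u, w)) (p :: α ++ [p']) (p :: α ++ [p']).tail) :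
    ∃ v ∈ α, v ∈ e := by
  rw [edges_cons_concat hh hl, List.cons_append, List.mem_cons, List.mem_append,
    List.mem_singleton] at he
  rcases he with rfl | he | rfl
  · exact ⟨c₁, List.mem_of_head? hh, Sym2.mem_mk_right _ _⟩
  · exact ⟨e.out.1, forall_mem_of_mem_edges α e he _ (Sym2.out_fst_mem e), Sym2.out_fst_mem e⟩
  · exact ⟨c₂, List.mem_of_getLast? hl, Sym2.mem_mk_left _ _⟩

/-- Replacing the middle block of a duplicate-free concatenation by a duplicate-free block that
avoids the two outer blocks keeps it duplicate-free. [folklore] -/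
theorem nodup_splice {W : Type*} {X Y₀ Y Z : List W} (h₀ : (X ++ Y₀ ++ Z).Nodup) (hY : Y.Nodup)
    (hX : ∀ e ∈ Y, e ∉ X) (hZ : ∀ e ∈ Y, e ∉ Z) : (X ++ Y ++ Z).Nodup := by
  rw [List.nodup_append, List.nodup_append] at h₀ ⊢
  obtain ⟨⟨hXn, -, -⟩, hZn, hXZ⟩ := h₀
  refine ⟨⟨hXn, hY, fun a ha b hb hab => hX b hb (hab ▸ ha)⟩, hZn, fun a ha b hb hab => ?_⟩
  rcases List.mem_append.1 ha with ha | ha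
  · exact hXZ a (List.mem_append_left _ ha) b hb hab
  · exact hZ a ha (hab ▸ hb)

/-- Splicing chains: replacing the middle block of a chain by a chain with the same first and
last entries gives a chain. [folklore] -/
theorem isChain_splice {R : V → V → Prop} {X α₀ α Z : List V} {c₁ c₂ : V}
    (h₀ : List.IsChain R (X ++ α₀ ++ Z)) (hα : List.IsChain R α)
    (hh₀ : α₀.head? = some c₁) (hh : α.head? = some c₁)
    (hl₀ : α₀.getLast? = some c₂) (hl : α.getLast? = some c₂) :
    List.IsChain R (X ++ α ++ Z) := by
  rw [List.isChain_append, List.isChain_append] at h₀ ⊢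
  obtain ⟨⟨hX, -, hXα⟩, hZ, hαZ⟩ := h₀
  have e1 : (X ++ α).getLast? = some c₂ := by rw [List.getLast?_append, hl, Option.some_or]
  have e2 : (X ++ α₀).getLast? = some c₂ := by rw [List.getLast?_append, hl₀, Option.some_or]
  refine ⟨⟨hX, hα, fun x hx y hy => hXα x hx y ?_⟩, hZ, fun x hx y hy => hαZ x ?_ y hy⟩
  · rw [Option.mem_def, hh₀]; rw [Option.mem_def, hh] at hy; exact hy
  · rw [Option.mem_def, e2]; rw [Option.mem_def, e1] at hx; exact hx

/-- The first entry of a spliced concatenation. [folklore] -/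
theorem head?_splice_mid {X α₀ α Z : List V} {c₁ : V} (hh₀ : α₀.head? = some c₁)
    (hh : α.head? = some c₁) : (X ++ α ++ Z).head? = (X ++ α₀ ++ Z).head? := by
  simp only [List.head?_append, hh, hh₀]

/-- The last entry of a spliced concatenation. [folklore] -/
theorem getLast?_splice_mid {X α₀ α Z : List V} {c₂ : V} (hl₀ : α₀.getLast? = some c₂)
    (hl : α.getLast? = some c₂) : (X ++ α ++ Z).getLast? = (X ++ α₀ ++ Z).getLast? := by
  simp only [List.getLast?_append, hl, hl₀]

/-- **First/last-visit decomposition.** A list containing an entry failing `p` splits as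
`β ++ α ++ β'` with `α` running from the first entry failing `p` to the last one and `β`, `β'`
satisfying `p` throughout. [folklore] -/
theorem exists_split_first_last (p : V → Bool) {L : List V} (hL : ∃ v ∈ L, p v = false) :
    ∃ (β α β' : List V) (c₁ c₂ : V), L = β ++ α ++ β' ∧ α.head? = some c₁ ∧
      α.getLast? = some c₂ ∧ p c₁ = false ∧ p c₂ = false ∧ (∀ v ∈ β, p v = true) ∧
      (∀ v ∈ β', p v = true) := by
  obtain ⟨v, hv, hpv⟩ := hL
  set R := L.dropWhile p with hR
  have hRne : R ≠ [] := by
    intro h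
    rw [hR, List.dropWhile_eq_nil_iff] at h
    rw [h v hv] at hpv
    exact Bool.noConfusion hpv
  have hc₁ : p (R.head hRne) = false := List.head_dropWhile_not p hRne
  set S := R.reverse.dropWhile p with hS
  have hSne : S ≠ [] := by
    intro h
    rw [hS, List.dropWhile_eq_nil_iff] at h
    have h' := h (R.head hRne) (List.mem_reverse.2 (List.head_mem hRne))
    rw [hc₁] at h'
    exact Bool.noConfusion h'
  have hc₂ : p (S.head hSne) = false := List.head_dropWhile_not p hSne
  have h1 : S.reverse ++ (R.reverse.takeWhile p).reverse = R := by
    rw [← List.reverse_append, hS, List.takeWhile_append_dropWhile, List.reverse_reverse]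
  have hSr : S.reverse ≠ [] := List.reverse_ne_nil_iff.2 hSne
  refine ⟨L.takeWhile p, S.reverse, (R.reverse.takeWhile p).reverse, R.head hRne, S.head hSne,
    ?_, ?_, ?_, hc₁, hc₂, fun v hv => List.mem_takeWhile_imp hv,
    fun v hv => List.mem_takeWhile_imp (List.mem_reverse.1 hv)⟩
  · rw [List.append_assoc, h1, hR, List.takeWhile_append_dropWhile]
  · rw [← List.head?_eq_some_head hRne]
    conv_rhs => rw [← h1]
    rw [List.head?_append, List.head?_eq_some_head hSr, Option.some_or]
  · rw [List.getLast?_reverse, List.head?_eq_some_head hSne]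

/-- **Uniqueness of the first/last-visit decomposition**: for `L = β ++ α ++ β'` as above, the
prefix `β`, the first and last entries of `α` and the suffix `β'` are computed by
`takeWhile`/`dropWhile` from the two ends. [folklore] -/
theorem split_first_last_eq (p : V → Bool) {β α β' : List V} {c₁ c₂ : V}
    (hh : α.head? = some c₁) (hl : α.getLast? = some c₂) (h₁ : p c₁ = false) (h₂ : p c₂ = false)
    (hβ : ∀ v ∈ β, p v = true) (hβ' : ∀ v ∈ β', p v = true) :
    (β ++ α ++ β').takeWhile p = β ∧ ((β ++ α ++ β').dropWhile p).head? = some c₁ ∧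
      ((β ++ α ++ β').reverse.dropWhile p).head? = some c₂ ∧
      ((β ++ α ++ β').reverse.takeWhile p).reverse = β' := by
  obtain ⟨αt, rfl⟩ : ∃ t, α = c₁ :: t := by
    cases α with
    | nil => simp at hh
    | cons a t => exact ⟨t, by simp only [List.head?_cons, Option.some.injEq] at hh; rw [hh]⟩
  obtain ⟨αi, hαr⟩ : ∃ i, (c₁ :: αt).reverse = c₂ :: i := by
    obtain ⟨d, i, hd⟩ :=
      List.exists_cons_of_ne_nil (List.reverse_ne_nil_iff.2 (List.cons_ne_nil c₁ αt))
    refine ⟨i, ?_⟩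
    have h' : (c₁ :: αt).reverse.head? = some c₂ := by rw [List.head?_reverse]; exact hl
    rw [hd, List.head?_cons, Option.some.injEq] at h'
    rw [hd, h']
  have h₁' : ¬ (p c₁ = true) := by simp [h₁]
  have h₂' : ¬ (p c₂ = true) := by simp [h₂]
  have hβr : ∀ v ∈ β'.reverse, p v = true := fun v hv => hβ' v (List.mem_reverse.1 hv)
  refine ⟨?_, ?_, ?_, ?_⟩
  · rw [List.append_assoc, List.takeWhile_append_of_pos hβ, List.cons_append,
      List.takeWhile_cons_of_neg h₁', List.append_nil]
  · rw [List.append_assoc, List.dropWhile_append_of_pos hβ, List.cons_append,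
      List.dropWhile_cons_of_neg h₁']
    rfl
  · rw [List.reverse_append, List.reverse_append, hαr, List.dropWhile_append_of_pos hβr,
      List.cons_append, List.dropWhile_cons_of_neg h₂']
    rfl
  · rw [List.reverse_append, List.reverse_append, hαr, List.takeWhile_append_of_pos hβr,
      List.cons_append, List.takeWhile_cons_of_neg h₂', List.append_nil, List.reverse_reverse]

/-- The first/last-visit decomposition with prescribed prefix, end entries and suffix, as a
condition on the `takeWhile`/`dropWhile` data. [folklore] -/
theorem split_first_last_iff (p : V → Bool) {L β β' : List V} {c₁ c₂ : V} (h₁ : p c₁ = false)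
    (h₂ : p c₂ = false) (hβ : ∀ v ∈ β, p v = true) (hβ' : ∀ v ∈ β', p v = true) :
    ((∃ v ∈ L, p v = false) ∧ L.takeWhile p = β ∧ (L.dropWhile p).head? = some c₁ ∧
        (L.reverse.dropWhile p).head? = some c₂ ∧ (L.reverse.takeWhile p).reverse = β') ↔
      ∃ α, L = β ++ α ++ β' ∧ α.head? = some c₁ ∧ α.getLast? = some c₂ := by
  constructor
  · rintro ⟨hex, e1, e2, e3, e4⟩
    obtain ⟨β₂, α, β₂', d₁, d₂, hdec, hh, hl, hd₁, hd₂, hβ₂, hβ₂'⟩ :=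
      exists_split_first_last p hex
    obtain ⟨f1, f2, f3, f4⟩ := split_first_last_eq p hh hl hd₁ hd₂ hβ₂ hβ₂'
    rw [hdec] at e1 e2 e3 e4
    rw [f1] at e1
    rw [f2, Option.some.injEq] at e2
    rw [f3, Option.some.injEq] at e3
    rw [f4] at e4
    subst e1 e2 e3 e4
    exact ⟨α, hdec, hh, hl⟩
  · rintro ⟨α, rfl, hh, hl⟩
    obtain ⟨f1, f2, f3, f4⟩ := split_first_last_eq p hh hl h₁ h₂ hβ hβ'
    refine ⟨⟨c₁, ?_, h₁⟩, f1, f2, f3, f4⟩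
    exact List.mem_append_left _ (List.mem_append_right _ (List.mem_of_head? hh))

end EdgeLists

end Literature.Probability.RandomPlanarGeometry.SAW
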